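import Summits.RiemannHypothesis.RiemannHypothesis.Theorems.GroundBartaEvenWinsBeyondArchDeflationMajorant
import HarnessLib

/-!
# RiemannHypothesis / GroundBarta — rung 4 (`EvenWinsBeyondArch`, stmt-RiemannHypothesis-18807 / 18085):
# the archimedean majorant for a trial vector CUT INSIDE the window

Helper file (`--supports stmt-RiemannHypothesis-18085`), RH-free, Mathlib + landed tree files only, no
definitions, no named facts.  Prover B (gen 6 of unit `sr-gb-rung-b`).

For the ENDPOINT CELL `a* = (log 5)/2` of the window ladder the trial vectors are `v = 𝟙_{[-c',c']}·g` (`g ∈ C²`,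
`c'` rational) while the test window is `[-c, c]` with `c' ≤ c` (`c = a*` irrational).  `…DeflationMajorant.lean`
(prover B, gen 3) gives the square-integrable majorant of `y ↦ ∫₀^∞ ρ(t)|2v(y) − v(y−t) − v(y+t)| dt` on the open
support `(-c', c')`; here we extend it to the whole test window `(-c, c)` minus the two points `±c'` (where the
absolute integral diverges logarithmically): on the shell `c' < |y| < c` the vector vanishes at `y`, the second
differences vanish for `t < |y| − c'` and are `≤ 2‖g‖_∞` beyond, and `∫_d^∞ ρ ≤ 3 d^{-1/4} + ∫_1^∞ ρ`, `d = |y| − c'`,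
is square integrable on the shell.

* `dt_integrableOn_rpow_shell_right/left`, `dt_memLp_indicator_rpow_shell` — `(|y| − c')^{-1/4} 𝟙_{c'<|y|<c} ∈ L²`;
* **`dt_exists_majorant_of_contDiff_cut`** — the a.e. majorant on `(-c, c)` (input of `…DeflationWindowImageAE`).
-/

set_option linter.dupNamespace false

noncomputable section

open MeasureTheory Set Filter
open scoped Topology ENNReal NNReal ComplexConjugate BigOperators

namespace Summit.RiemannHypothesis.RiemannHypothesis.Theorems.EvenWinsBeyondArch

open Literature.NumberTheory.LFunctions

/-! ## Square integrability of the shell singularity `(|y| − c')^{-1/4}` -/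

/-- `y ↦ (y − c')^{-1/2}` is integrable on `(c', c)`. [folklore] -/
theorem dt_integrableOn_rpow_shell_right {c c' : ℝ} (hcc : c' ≤ c) :
    IntegrableOn (fun y : ℝ ↦ (y - c') ^ (-(1 / 2 : ℝ))) (Ioo c' c) := by
  have h := (intervalIntegral.intervalIntegrable_rpow' (a := 0) (b := c - c')
    (by norm_num : (-1 : ℝ) < -(1 / 2))).comp_sub_right c'
  rw [zero_add, show c - c' + c' = c by ring] at h
  rw [intervalIntegrable_iff_integrableOn_Ioo_of_le hcc] at h
  exact h

/-- `y ↦ (−c' − y)^{-1/2}` is integrable on `(-c, -c')`. [folklore] -/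
theorem dt_integrableOn_rpow_shell_left {c c' : ℝ} (hcc : c' ≤ c) :
    IntegrableOn (fun y : ℝ ↦ (-c' - y) ^ (-(1 / 2 : ℝ))) (Ioo (-c) (-c')) := by
  have h := (intervalIntegral.intervalIntegrable_rpow' (a := 0) (b := c - c')
    (by norm_num : (-1 : ℝ) < -(1 / 2))).comp_sub_left (-c')
  rw [sub_zero, show -c' - (c - c') = -c by ring] at h
  have h' := h.symm
  rw [intervalIntegrable_iff_integrableOn_Ioo_of_le (by linarith)] at h'
  exact h'

/-- `𝟙_{c' < |y| < c}(y) (|y| − c')^{-1/4} ∈ L²(ℝ)` (`0 < c'`). [folklore] -/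
theorem dt_memLp_indicator_rpow_shell {c c' : ℝ} (hc' : 0 < c') (hcc : c' ≤ c) :
    MemLp ({y : ℝ | c' < |y| ∧ |y| < c}.indicator fun y : ℝ ↦ (|y| - c') ^ (-(1 / 4 : ℝ))) 2 volume := by
  have hT : MeasurableSet {y : ℝ | c' < |y| ∧ |y| < c} :=
    (measurableSet_lt measurable_const continuous_abs.measurable).inter
      (measurableSet_lt continuous_abs.measurable measurable_const)
  rw [memLp_indicator_iff_restrict hT]
  have hmeas : AEStronglyMeasurable (fun y : ℝ ↦ (|y| - c') ^ (-(1 / 4 : ℝ)))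
      (volume.restrict {y : ℝ | c' < |y| ∧ |y| < c}) :=
    ((continuous_abs.measurable.sub measurable_const).pow_const _).aestronglyMeasurable
  rw [memLp_two_iff_integrable_sq_norm hmeas]
  -- the shell is contained in `(-c, -c') ∪ (c', c)`
  have hsub : {y : ℝ | c' < |y| ∧ |y| < c} ⊆ Ioo (-c) (-c') ∪ Ioo c' c := by
    intro y hy
    have hy' : c' < |y| ∧ |y| < c := hy
    rcases le_or_gt 0 y with h0 | h0
    · rw [abs_of_nonneg h0] at hy'; exact Or.inr ⟨hy'.1, hy'.2⟩
    · rw [abs_of_neg h0] at hy'; exact Or.inl ⟨by linarith [hy'.2], by linarith [hy'.1]⟩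
  have hR : IntegrableOn (fun y : ℝ ↦ ‖(|y| - c') ^ (-(1 / 4 : ℝ))‖ ^ 2) (Ioo c' c) := by
    refine (dt_integrableOn_rpow_shell_right hcc).congr_fun (fun y hy ↦ ?_) measurableSet_Ioo
    have hy0 : 0 < y := hc'.trans hy.1
    have hpos : 0 < y - c' := by linarith [hy.1]
    rw [abs_of_pos hy0, Real.norm_of_nonneg (Real.rpow_nonneg hpos.le _), ← Real.rpow_natCast,
      ← Real.rpow_mul hpos.le]
    norm_num
  have hL : IntegrableOn (fun y : ℝ ↦ ‖(|y| - c') ^ (-(1 / 4 : ℝ))‖ ^ 2) (Ioo (-c) (-c')) := by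
    refine (dt_integrableOn_rpow_shell_left hcc).congr_fun (fun y hy ↦ ?_) measurableSet_Ioo
    have hy0 : y < 0 := by linarith [hy.2]
    have hpos : 0 < -c' - y := by linarith [hy.2]
    rw [abs_of_neg hy0, show -y - c' = -c' - y by ring, Real.norm_of_nonneg (Real.rpow_nonneg hpos.le _),
      ← Real.rpow_natCast, ← Real.rpow_mul hpos.le]
    norm_num
  exact (hL.union hR).mono_set hsub

/-! ## The majorant for a `C²` vector cut inside the window -/

/-- **Archimedean majorant for a `C²` vector cut inside the window.**  For `0 < c' ≤ c`, `g ∈ C²(ℝ)` and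
`v = g 𝟙_{[-c',c']}` (cast to `ℂ`), there is `m ∈ L²(ℝ)` such that for almost every `y ∈ (-c, c)` (all except
`y = ±c'`) the archimedean second differences `t ↦ ρ(t) |2v(y) − v(y−t) − v(y+t)|` are integrable on `(0, ∞)` with
integral `≤ m(y)`.  (On `(-c', c')`: `…DeflationMajorant`; on the shell `c' < |y| < c`: the second differences
vanish for `t < |y| − c'` and are `≤ 2‖g‖_∞` beyond, and `∫_d^∞ ρ ≤ 3d^{-1/4} + ∫_1^∞ ρ`.) [folklore] -/
theorem dt_exists_majorant_of_contDiff_cut {c c' : ℝ} (hc' : 0 < c') (hcc : c' ≤ c) {g : ℝ → ℝ}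
    (hg : ContDiff ℝ 2 g) {v : ℝ → ℂ} (hv : ∀ y, v y = (((Icc (-c') c').indicator g y : ℝ) : ℂ)) :
    ∃ m : ℝ → ℝ, MemLp m 2 volume ∧
      (∀ᵐ y : ℝ, y ∈ Ioo (-c) c →
        IntegrableOn (fun t ↦ weilArchDensity t * ‖2 * v y - v (y - t) - v (y + t)‖) (Ioi 0) ∧
          ∫ t in Ioi 0, weilArchDensity t * ‖2 * v y - v (y - t) - v (y + t)‖ ≤ m y) := by
  -- the inner majorant on `(-c', c')`
  obtain ⟨m₁, hm₁, hHi₁, hHm₁⟩ := dt_exists_majorant_of_contDiff hc' hg hv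
  -- a bound for `g` on the support
  obtain ⟨G₀, hG₀⟩ := isCompact_Icc.exists_bound_of_continuousOn
    (hg.continuous.continuousOn : ContinuousOn g (Icc (-c') c'))
  have hG₀0 : 0 ≤ G₀ := (norm_nonneg _).trans (hG₀ 0 ⟨by linarith, by linarith⟩)
  set C₁ : ℝ := ∫ t in Ici (1 : ℝ), weilArchDensity t with hC₁
  have hC₁0 : 0 ≤ C₁ :=
    setIntegral_nonneg measurableSet_Ici fun t (ht : 1 ≤ t) ↦ (weilArchDensity_pos (by linarith)).le
  -- pointwise facts about `v`
  have hvb : ∀ z, ‖v z‖ ≤ G₀ := by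
    intro z
    rw [hv z, Complex.norm_real]
    by_cases hz : z ∈ Icc (-c') c'
    · rw [indicator_of_mem hz]; exact hG₀ z hz
    · rw [indicator_of_notMem hz, norm_zero]; exact hG₀0
  have hvout : ∀ z, z ∉ Icc (-c') c' → v z = 0 := fun z hz ↦ by rw [hv z, indicator_of_notMem hz]; simp
  have hvm : Measurable v := by
    have e : v = fun y ↦ (((Icc (-c') c').indicator g y : ℝ) : ℂ) := funext hv
    rw [e]
    exact Complex.measurable_ofReal.comp ((hg.continuous.measurable).indicator measurableSet_Icc)
  -- the shell majorant and the total majorant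
  set T : Set ℝ := {y : ℝ | c' < |y| ∧ |y| < c} with hT
  have hTm : MeasurableSet T :=
    (measurableSet_lt measurable_const continuous_abs.measurable).inter
      (measurableSet_lt continuous_abs.measurable measurable_const)
  set m₂ : ℝ → ℝ := fun y ↦ (6 * G₀) * T.indicator (fun y : ℝ ↦ (|y| - c') ^ (-(1 / 4 : ℝ))) y +
    T.indicator (fun _ ↦ 2 * G₀ * C₁) y with hm₂
  set m : ℝ → ℝ := fun y ↦ m₂ y + ‖m₁ y‖ with hm
  have hm₂0 : ∀ y, 0 ≤ m₂ y := by
    intro y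
    simp only [hm₂]
    by_cases hy : y ∈ T
    · rw [indicator_of_mem hy, indicator_of_mem hy]
      have hd : 0 < |y| - c' := by have := hy.1; linarith
      have := Real.rpow_nonneg hd.le (-(1 / 4 : ℝ))
      positivity
    · rw [indicator_of_notMem hy, indicator_of_notMem hy]; simp
  refine ⟨m, ?_, ?_⟩
  · -- `m ∈ L²`
    have hvolT : volume T ≠ ⊤ := by
      refine ne_top_of_le_ne_top (by rw [Real.volume_Ioo]; exact ENNReal.ofReal_ne_top : volume (Ioo (-c) c) ≠ ⊤)
        (measure_mono fun y hy ↦ ?_)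
      exact ⟨by linarith [neg_abs_le y, hy.2], lt_of_le_of_lt (le_abs_self y) hy.2⟩
    have m2a : MemLp (fun y ↦ (6 * G₀) * T.indicator (fun y : ℝ ↦ (|y| - c') ^ (-(1 / 4 : ℝ))) y) 2 volume :=
      (dt_memLp_indicator_rpow_shell hc' hcc).const_mul _
    have m2b : MemLp (T.indicator fun _ : ℝ ↦ 2 * G₀ * C₁) 2 volume :=
      memLp_indicator_const 2 hTm _ (Or.inr hvolT)
    have m2 : MemLp m₂ 2 volume := m2a.add m2b
    exact m2.add hm₁.norm
  · -- the bound, for all `y ∈ (-c, c)` except `±c'`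
    have hex : ∀ᵐ y : ℝ, y ∉ ({-c', c'} : Set ℝ) :=
      measure_eq_zero_iff_ae_notMem.1 ((Set.toFinite ({-c', c'} : Set ℝ)).measure_zero volume)
    filter_upwards [hex] with y hy hyc
    simp only [mem_insert_iff, mem_singleton_iff, not_or] at hy
    rcases lt_or_gt_of_ne (show |y| ≠ c' from fun h ↦ by
      rcases le_or_gt 0 y with h0 | h0
      · rw [abs_of_nonneg h0] at h; exact hy.2 h
      · rw [abs_of_neg h0] at h; exact hy.1 (by linarith)) with hin | hout
    · -- inside the support: the inner majorant
      have hyo : y ∈ Ioo (-c') c' := ⟨by linarith [neg_abs_le y, abs_lt.1 hin |>.1], (abs_lt.1 hin).2⟩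
      refine ⟨hHi₁ y hyo, (hHm₁ y hyo).trans ?_⟩
      simp only [hm]
      linarith [le_abs_self (m₁ y), hm₂0 y, Real.norm_eq_abs (m₁ y)]
    · -- on the shell
      set d : ℝ := |y| - c' with hdd
      have hd : 0 < d := by rw [hdd]; linarith
      have hyT : y ∈ T := ⟨hout, by
        rcases le_or_gt 0 y with h0 | h0
        · rw [abs_of_nonneg h0]; exact hyc.2
        · rw [abs_of_neg h0]; linarith [hyc.1]⟩
      have hvy : v y = 0 := hvout y fun h ↦ by
        have : |y| ≤ c' := abs_le.2 ⟨h.1, h.2⟩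
        linarith
      -- the second differences vanish for `t < d` and are `≤ 2 G₀` always
      have hzero : ∀ t ∈ Ioo 0 d, ‖2 * v y - v (y - t) - v (y + t)‖ = 0 := by
        intro t ht
        have h1 : y - t ∉ Icc (-c') c' := by
          intro h
          rcases le_or_gt 0 y with h0 | h0
          · have hay : |y| = y := abs_of_nonneg h0
            rw [hdd, hay] at ht; linarith [h.2, ht.2]
          · have hay : |y| = -y := abs_of_neg h0
            have hout' : c' < -y := hay ▸ hout
            linarith [h.1, ht.1]
        have h2 : y + t ∉ Icc (-c') c' := by
          intro h
          rcases le_or_gt 0 y with h0 | h0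
          · have hay : |y| = y := abs_of_nonneg h0
            have hout' : c' < y := hay ▸ hout
            linarith [h.2, ht.1]
          · have hay : |y| = -y := abs_of_neg h0
            rw [hdd, hay] at ht; linarith [h.1, ht.2]
        rw [hvy, hvout _ h1, hvout _ h2]; simp
      have hlarge : ∀ t, ‖2 * v y - v (y - t) - v (y + t)‖ ≤ 2 * G₀ := by
        intro t
        rw [hvy, mul_zero, zero_sub]
        calc ‖-v (y - t) - v (y + t)‖ ≤ ‖-v (y - t)‖ + ‖v (y + t)‖ := norm_sub_le _ _
          _ ≤ G₀ + G₀ := by rw [norm_neg]; exact add_le_add (hvb _) (hvb _)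
          _ = 2 * G₀ := by ring
      -- the dominating function
      set H : ℝ → ℝ := fun t ↦ (Ici d).indicator (fun t ↦ 2 * G₀ * weilArchDensity t) t with hH
      have iR : IntegrableOn (fun t ↦ 2 * G₀ * weilArchDensity t) (Ici d) :=
        (dt_integrableOn_weilArchDensity_Ici hd).const_mul _
      have hHint : IntegrableOn H (Ioi 0) := (iR.integrable_indicator measurableSet_Ici).integrableOn
      have hdom : ∀ t ∈ Ioi (0 : ℝ), weilArchDensity t * ‖2 * v y - v (y - t) - v (y + t)‖ ≤ H t := by
        intro t (ht : 0 < t)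
        have hρ := (weilArchDensity_pos ht).le
        by_cases htd : t < d
        · rw [hzero t ⟨ht, htd⟩, mul_zero, hH]
          simp only
          by_cases h : t ∈ Ici d
          · rw [indicator_of_mem h]; exact mul_nonneg (by positivity) hρ
          · rw [indicator_of_notMem h]
        · rw [hH]
          simp only [indicator_of_mem (show t ∈ Ici d from not_lt.1 htd)]
          calc weilArchDensity t * ‖2 * v y - v (y - t) - v (y + t)‖
              ≤ weilArchDensity t * (2 * G₀) := mul_le_mul_of_nonneg_left (hlarge t) hρ
            _ = 2 * G₀ * weilArchDensity t := by ring
      have hmeas : AEStronglyMeasurable (fun t ↦ weilArchDensity t * ‖2 * v y - v (y - t) - v (y + t)‖)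
          (volume.restrict (Ioi 0)) := by
        refine (measurable_weilArchDensity.mul ?_).aestronglyMeasurable.restrict
        exact ((measurable_const.sub (hvm.comp (measurable_const.sub measurable_id))).sub
          (hvm.comp (measurable_const.add measurable_id))).norm
      have hint : IntegrableOn (fun t ↦ weilArchDensity t * ‖2 * v y - v (y - t) - v (y + t)‖) (Ioi 0) :=
        Integrable.mono' hHint hmeas ((ae_restrict_iff' measurableSet_Ioi).2 (Eventually.of_forall
          fun t ht ↦ by
            rw [Real.norm_of_nonneg (mul_nonneg (weilArchDensity_pos ht).le (norm_nonneg _))]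
            exact hdom t ht))
      refine ⟨hint, ?_⟩
      have h1 : ∫ t in Ioi 0, weilArchDensity t * ‖2 * v y - v (y - t) - v (y + t)‖ ≤ ∫ t in Ioi 0, H t :=
        setIntegral_mono_on hint hHint measurableSet_Ioi hdom
      have h2 : ∫ t in Ioi 0, H t = 2 * G₀ * ∫ t in Ici d, weilArchDensity t := by
        simp only [hH]
        rw [integral_indicator measurableSet_Ici, Measure.restrict_restrict measurableSet_Ici,
          inter_eq_left.2 (Ici_subset_Ioi.2 hd), integral_const_mul]
      have h3 := dt_setIntegral_weilArchDensity_Ici_le hd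
      have h4 := dt_negLog_le_rpow hd
      have hmy : m y = (6 * G₀) * d ^ (-(1 / 4 : ℝ)) + 2 * G₀ * C₁ + ‖m₁ y‖ := by
        simp only [hm, hm₂, indicator_of_mem hyT, hdd]
      rw [hmy]
      have h6 : ∫ t in Ici d, weilArchDensity t ≤ 3 * d ^ (-(1 / 4 : ℝ)) + C₁ := by linarith [h3, h4]
      calc ∫ t in Ioi 0, weilArchDensity t * ‖2 * v y - v (y - t) - v (y + t)‖
          ≤ 2 * G₀ * ∫ t in Ici d, weilArchDensity t := by rw [← h2]; exact h1
        _ ≤ 2 * G₀ * (3 * d ^ (-(1 / 4 : ℝ)) + C₁) := mul_le_mul_of_nonneg_left h6 (by positivity)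
        _ ≤ (6 * G₀) * d ^ (-(1 / 4 : ℝ)) + 2 * G₀ * C₁ + ‖m₁ y‖ := by
            have := norm_nonneg (m₁ y); nlinarith

end Summit.RiemannHypothesis.RiemannHypothesis.Theorems.EvenWinsBeyondArch

end
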